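import Summits.BirchSwinnertonDyer.BirchSwinnertonDyer.Theorems.ThetaPartnerAtTwoSignedControlAtTwoOfPubFour
import Summits.BirchSwinnertonDyer.BirchSwinnertonDyer.Theorems.ThetaPartnerAtTwoSignedControlAtTwoH1SigmaCorankBound
import HarnessLib

/-!
# K4 `SignedControlAtTwo` (stmt-BirchSwinnertonDyer-20309) FROM THREE PRINTED FACTS — the PUB residue of line `eulerchar`
# after the corank bound `Greenberg1999.h1Sigma_zpCorank_le_degree ℚ` became a theorem (routes `ThetaPartnerAtTwo` /
# `ResidualThetaTransportAtTwo`; both copies of the decl)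

Crux K4, line `eulerchar` (skeleton v7 bce45018, lead `prover-bsd-wall-tp2-p3` g2: ONE stub `stub_pubGreenbergTwo` = PUB×4); width
seat `prover-bsd-wall-tp2-p3-w3` g4.

WHY. Width seat 3's `SignedEC.OfPubFour.signedControlAtTwo_of_pub4` derives K4 from the FOUR named facts {Cassels' theorem
(Greenberg Prop. 4.13 special case), Greenberg Prop. 4.12, the corank bound pp. 119–120, weak Leopoldt §5 p. 140 / Kato Thm. 12.4}.
The corank bound `Greenberg1999.h1Sigma_zpCorank_le_degree ℚ` is now PROVED in the tree
(`SignedEC.H1SigmaCorank.h1Sigma_zpCorank_le_degree_holds_rat`, this seat's `…H1SigmaCorankBound.lean`: Tate local duality in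
order form from the proved local Euler–Poincaré characteristic + Milne I.3.8 + a growth lemma). THIS FILE records the honest
residue kernel-exactly: **K4 ⟸ THREE printed facts** {Cassels, Prop. 4.12, weak Leopoldt}, for BOTH route copies of the decl.

WHAT. `signedControlAtTwo_of_pub3` (TP2 decl), `signedControlAtTwo_rtt_of_pub3` (RTT decl). CONDITIONAL results (the gate
records `proof.conditional`); THEOREMS ONLY (no definition, no named fact, no instance, no `sorry`); closes no item by itself;
BSD is not proved by any of this.

References: [GreenbergLNM1716] R. Greenberg, LNM 1716 (1999), §4 Props. 4.12–4.13, pp. 119–122, §5 p. 140; [Cassels1964ArithmeticVII];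
[Kato2004Asterisque] Thm. 12.4; [BDKim2013] Cor. 3.15; [Kobayashi2003] Thm. 1.2, §8.4.
-/

set_option autoImplicit false
-- the Theorems namespace of this sub repeats the summit name by design (D-0017 nested layout)
set_option linter.dupNamespace false

noncomputable section

namespace Summit.BirchSwinnertonDyer.BirchSwinnertonDyer.Theorems.SignedEC.OfPubThree

open Literature.NumberTheory.EllipticCurves

/-- **K4 `SignedControlAtTwo` (route `ThetaPartnerAtTwo`'s decl, BY NAME) from the THREE printed facts of Greenberg LNM 1716 /
Kato that the tree does not prove** — Cassels' theorem, Prop. 4.12, weak Leopoldt — the corank-bound antecedent of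
`signedControlAtTwo_of_pub4` being the tree theorem `H1SigmaCorank.h1Sigma_zpCorank_le_degree_holds_rat`.
[cite: GreenbergLNM1716, Props. 4.12–4.13, pp. 119–122, 140] [cite: Kato2004Asterisque, Thm. 12.4] [cite: BDKim2013, Cor. 3.15] -/
theorem signedControlAtTwo_of_pub3 (hC : Greenberg1999.casselsSurjectivity_H1Sigma ℚ)
    (h412 : Greenberg1999.prop412_noFiniteSubmodule_H1Sigma_of_rank_one) (hWL : Greenberg1999.h1SigmaInfty_rank_eq_one) :
    Summit.BirchSwinnertonDyer.BirchSwinnertonDyer.Theses.ThetaPartnerAtTwo.SignedControlAtTwo :=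
  OfPubFour.signedControlAtTwo_of_pub4 hC h412 H1SigmaCorank.h1Sigma_zpCorank_le_degree_holds_rat hWL

/-- **The same for route `ResidualThetaTransportAtTwo`'s copy of the decl** (identical body).
[cite: GreenbergLNM1716, Props. 4.12–4.13, pp. 119–122, 140] [cite: Kato2004Asterisque, Thm. 12.4] -/
theorem signedControlAtTwo_rtt_of_pub3 (hC : Greenberg1999.casselsSurjectivity_H1Sigma ℚ)
    (h412 : Greenberg1999.prop412_noFiniteSubmodule_H1Sigma_of_rank_one) (hWL : Greenberg1999.h1SigmaInfty_rank_eq_one) :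
    Summit.BirchSwinnertonDyer.BirchSwinnertonDyer.Theses.ResidualThetaTransportAtTwo.SignedControlAtTwo :=
  OfPubFour.signedControlAtTwo_rtt_of_pub4 hC h412 H1SigmaCorank.h1Sigma_zpCorank_le_degree_holds_rat hWL

end Summit.BirchSwinnertonDyer.BirchSwinnertonDyer.Theorems.SignedEC.OfPubThree

end
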